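import Literature.AlgebraicGeometry.Motives.UniversalHypersurfaceSmooth
import HarnessLib

/-!
# The regular locus of the universal hypersurface: the universal family of degree-`d` hypersurfaces in `ℙⁿ⁺¹`
# INCLUDING its singular members, minus the fibre-singular points, is smooth over `S^d`

Family `hodge`, layer `Literature/AlgebraicGeometry/Motives`. Sequel of `UniversalHypersurfaceFamily` /
`UniversalHypersurfaceSmooth` (Voisin II §6.2.1; Hartshorne III Thm. 10.2). There the universal hypersurface
`𝒴 = V₊(F) ⊆ ℙⁿ⁺¹_R`, `R = k[a_m]`, `F = Σ a_m x^m`, is restricted to the base `U ⊆ S^d = Spec R` of NONSINGULAR forms,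
giving the smooth projective family `family k n d`. For the local study of a DEGENERATION (the monodromy of a meridian of
the discriminant: Picard–Lefschetz, Arnold–Gusein-Zade–Varchenko II §1.1; the crux K1 of
`Summits/HodgeConjecture/HodgeConjecture/Theses/CyclicUnitaryPowers.lean`) one needs the family over a disc MEETING the
discriminant, i.e. singular members too. The right total space is the **regular locus**

  `𝒴° := 𝒴 ∖ Σ`,  `Σ = V₊(F, ∂₀F, …, ∂_{n+1}F)` (`singularSet`) = the pairs (form, singular point of its hypersurface):

an open subscheme of `𝒴` which CONTAINS every singular member minus its singular points, and on which the projection to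
`S^d` is still smooth of relative dimension `n` (Jacobian criterion at every point where some partial does not vanish:
exactly the Euler charts `D₊(xᵢ ∂ⱼF)` of `UniversalHypersurfaceSmooth`, whose smoothness over `R` was proved there over
ALL of `Spec R`). Contents:

* `regularLocus k n d : (totalSpace k n d).Opens`, `mem_regularLocus_iff` (some `∂ⱼF ∉ 𝔭`),
  `preimage_baseOpens_le_regularLocus` (`𝒴_U ⊆ 𝒴°`);
* `regularToSpec k n d : 𝒴° → S^d` and **`smoothOfRelativeDimension_regularToSpec`** (smooth of relative dimension `n`,
  `d ≥ 1`);
* `affineBase k n d` (`S^d` as a `k`-scheme), `regularTotal k n d` (`𝒴°` as a `k`-scheme), `regularFamily : regularTotal ⟶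
  affineBase`, with `smoothOfRelativeDimension_regularTotal_hom` (`𝒴°` is smooth over `k` of relative dimension
  `n + #{m}`), `locallyOfFiniteType_regularTotal_hom`, `isSeparated_regularTotal_hom`, `smooth_regularFamily_left`;
* `totalToRegular : total k n d ⟶ regularTotal k n d`, the open immersion of the smooth family, over `baseToAffine`.

So `𝒴°(ℂ)` is a real manifold (`Motives.ComplexPoints.chartedSpace`) on which `𝒴°(ℂ) → S^d(ℂ)` is a submersion
(`ComplexPoints.surjective_mfderiv_map`) — the ambient space of the geometric monodromy construction.

## References

* [VoisinHodgeII2003] C. Voisin, Hodge Theory and Complex Algebraic Geometry II, CUP 2003, §6.2.1, §2.3.1.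
* [Hartshorne1977] R. Hartshorne, Algebraic Geometry (1977), I Ex. 5.8, III Thm. 10.2, Example 10.0.1.
* [ArnoldGuseinzadeVarchenko2012] V. I. Arnold, S. M. Gusein-Zade, A. N. Varchenko, Singularities of Differentiable Maps,
  Vol. 2, Part I §1.1.
-/

noncomputable section

open CategoryTheory AlgebraicGeometry MvPolynomial HomogeneousLocalization TopologicalSpace Limits

universe u

namespace Literature.AlgebraicGeometry.Motives.UniversalHypersurface

variable (k : Type u) [Field k] (n d : ℕ)

attribute [local instance] MvPolynomial.gradedAlgebra ProjBaseChange.algebraBase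

/-- graded pieces of `R[x₀, …, x_{n+1}]` -/
local notation "𝒜" R => MvPolynomial.homogeneousSubmodule (Fin (n + 2)) R

/-! ### The regular locus -/

/-- **The regular locus `𝒴° = 𝒴 ∖ Σ` of the universal hypersurface**: the open set of points of `V₊(F) ⊆ ℙⁿ⁺¹_R` at
which not all partials `∂ⱼF` vanish (complement of the closed `singularSet`), i.e. the pairs (form, NONSINGULAR point of
its hypersurface), singular members included. [cite: Hartshorne1977, I Ex. 5.8] [cite: VoisinHodgeII2003, §2.3.1] -/
def regularLocus : (totalSpace k n d).Opens :=
  ⟨(totalι k n d) ⁻¹' (singularSet k n d)ᶜ,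
    (isClosed_singularSet k n d).isOpen_compl.preimage (totalι k n d).continuous⟩

/-- Membership in the regular locus: some partial `∂ⱼF` is not in the homogeneous prime of the point (the form `F` itself
always is, on `𝒴 = V₊(F)`). [cite: Hartshorne1977, I Ex. 5.8] -/
theorem mem_regularLocus_iff (y : totalSpace k n d) :
    y ∈ regularLocus k n d ↔ ∃ j, pderiv j (universalForm k n d) ∉ (totalι k n d y).asHomogeneousIdeal := by
  have hF : universalForm k n d ∈ (totalι k n d y).asHomogeneousIdeal := by
    have hmem : totalι k n d y ∈ ProjectiveSpectrum.zeroLocus (𝒜 (CoeffRing k n d)) {universalForm k n d} := by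
      rw [← range_totalι]; exact ⟨y, rfl⟩
    exact Set.singleton_subset_iff.mp hmem
  have key : totalι k n d y ∈ singularSet k n d ↔
      ∀ j, pderiv j (universalForm k n d) ∈ (totalι k n d y).asHomogeneousIdeal := by
    change (insert (universalForm k n d) (Set.range fun j => pderiv j (universalForm k n d)) :
        Set (MvPolynomial (Fin (n + 2)) (CoeffRing k n d))) ⊆
      ((totalι k n d y).asHomogeneousIdeal : Set (MvPolynomial (Fin (n + 2)) (CoeffRing k n d))) ↔ _
    rw [Set.insert_subset_iff, Set.range_subset_iff]
    exact ⟨fun h => h.2, fun h => ⟨hF, h⟩⟩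
  change ¬ (totalι k n d y ∈ singularSet k n d) ↔ _
  rw [key, not_forall]

/-- **The smooth family sits inside the regular locus**: `π⁻¹(U) ⊆ 𝒴°` (over a nonsingular form every point of the
hypersurface is nonsingular). [cite: VoisinHodgeII2003, §6.2.1] -/
theorem preimage_baseOpens_le_regularLocus :
    (totalToSpec k n d) ⁻¹ᵁ (baseOpens k n d) ≤ regularLocus k n d := fun y hy =>
  (mem_regularLocus_iff k n d y).2 (exists_pderiv_not_mem k n d y hy).2

/-- `𝒴° → S^d = Spec R`, the universal hypersurface with its fibre-singular points removed, over ALL forms.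
[cite: VoisinHodgeII2003, §6.2.1] -/
abbrev regularToSpec : (regularLocus k n d).toScheme ⟶ Spec (.of (CoeffRing k n d)) :=
  (regularLocus k n d).ι ≫ totalToSpec k n d

/-! ### Smoothness over `S^d` -/

/-- **`𝒴° → S^d` is smooth of relative dimension `n`** for `d ≥ 1` (Jacobian criterion in families, Hartshorne III
Thm. 10.2: `𝒴°` is covered by the Euler charts `D₊(xᵢ ∂ⱼF) ∩ 𝒴`, each smooth of relative dimension `n` over `Spec R` by
`smoothOfRelativeDimension_subschemePiece`; same assembly as `smoothOfRelativeDimension_familyHom`, with the base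
unrestricted). [cite: Hartshorne1977, III Thm. 10.2] -/
theorem smoothOfRelativeDimension_regularToSpec (hd : 0 < d) :
    SmoothOfRelativeDimension n (regularToSpec k n d) := by
  set W := regularLocus k n d with hW
  let piece : ∀ ij : Fin (n + 2) × Fin (n + 1), _ := fun ij =>
    ProjSubscheme.subschemePiece (idealSheaf k n d) (chartOpen k n d ij.1 ij.2)
  let 𝒲 : W.toScheme.OpenCover :=
    Scheme.Cover.mkOfCovers (Fin (n + 2) × Fin (n + 1))
      (fun ij => ((piece ij) ⁻¹ᵁ W).toScheme) (fun ij => piece ij ∣_ W)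
      (fun x => by
        have hx : (W.ι x : totalSpace k n d) ∈ regularLocus k n d := x.2
        obtain ⟨j, hj⟩ := (mem_regularLocus_iff k n d _).1 hx
        have hF : universalForm k n d ∈ (totalι k n d (W.ι x)).asHomogeneousIdeal := by
          have hmem : totalι k n d (W.ι x) ∈
              ProjectiveSpectrum.zeroLocus (𝒜 (CoeffRing k n d)) {universalForm k n d} := by
            rw [← range_totalι]; exact ⟨W.ι x, rfl⟩
          exact Set.singleton_subset_iff.mp hmem
        obtain ⟨ij, hij⟩ := exists_mem_basicOpen k n d (totalι k n d (W.ι x)) hF ⟨j, hj⟩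
        have hx' : (W.ι x : totalSpace k n d) ∈ (piece ij).opensRange := by
          rw [ProjSubscheme.opensRange_subschemePiece]
          exact hij
        obtain ⟨y, hy⟩ := hx'
        have hyW : y ∈ (piece ij) ⁻¹ᵁ W := by
          change piece ij y ∈ W
          rw [hy]
          exact x.2
        refine ⟨ij, ⟨y, hyW⟩, ?_⟩
        apply Subtype.ext
        rw [morphismRestrict_base_coe]
        exact hy)
      (fun ij => IsZariskiLocalAtTarget.restrict (P := @IsOpenImmersion) inferInstance W)
  refine IsZariskiLocalAtSource.of_openCover (P := @SmoothOfRelativeDimension n) 𝒲 fun ij => ?_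
  -- `(piece ij ∣_ W) ≫ W.ι ≫ totalToSpec = ((piece ij)⁻¹ W).ι ≫ piece ij ≫ totalToSpec`
  have h1 : SmoothOfRelativeDimension n (piece ij ≫ totalToSpec k n d) :=
    smoothOfRelativeDimension_subschemePiece k n d ij.1 ij.2 hd
  have h2 : SmoothOfRelativeDimension (0 + n) (((piece ij) ⁻¹ᵁ W).ι ≫ piece ij ≫ totalToSpec k n d) :=
    inferInstance
  rw [zero_add] at h2
  have heq : 𝒲.f ij ≫ regularToSpec k n d = ((piece ij) ⁻¹ᵁ W).ι ≫ piece ij ≫ totalToSpec k n d := by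
    change (piece ij ∣_ W) ≫ W.ι ≫ totalToSpec k n d = _
    rw [← Category.assoc, morphismRestrict_ι, Category.assoc]
  rw [heq]
  exact h2

/-! ### `𝒴°` as a `k`-scheme -/

/-- `S^d = Spec R` as a `k`-scheme (the affine space of all degree-`d` forms). [cite: VoisinHodgeII2003, §6.2.1] -/
def affineBase : SchemeOver k := Over.mk (specCoeffToSpec k n d)

/-- The regular locus `𝒴°` as a `k`-scheme, with structure map through `S^d`. [cite: VoisinHodgeII2003, §6.2.1] -/
def regularTotal : SchemeOver k := Over.mk (regularToSpec k n d ≫ specCoeffToSpec k n d)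

/-- `𝒴° → S^d` as a morphism of `k`-schemes. [cite: VoisinHodgeII2003, §6.2.1] -/
def regularFamily : regularTotal k n d ⟶ affineBase k n d := Over.homMk (regularToSpec k n d) rfl

/-- The underlying scheme morphism of `regularFamily` (`rfl`). [cite: VoisinHodgeII2003, §6.2.1] -/
theorem regularFamily_left : (regularFamily k n d).left = regularToSpec k n d := rfl

/-- `S^d → Spec k` is smooth of relative dimension `#{m}` (affine space; a copy of
`HodgeTheory.UniversalHypersurface.smoothOfRelativeDimension_specCoeffToSpec`, kept here to keep imports light).
[cite: Hartshorne1977, III §10 Example 10.0.1] -/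
theorem smoothOfRelativeDimension_affineBase_hom :
    SmoothOfRelativeDimension (Fintype.card (DegIndex n d)) (affineBase k n d).hom := by
  change SmoothOfRelativeDimension _ (specCoeffToSpec k n d)
  rw [HasRingHomProperty.Spec_iff (P := @SmoothOfRelativeDimension (Fintype.card (DegIndex n d))),
    CommRingCat.hom_ofHom]
  refine RingHom.locally_of RingHom.isStandardSmoothOfRelativeDimension_respectsIso _ ?_
  rw [RingHom.isStandardSmoothOfRelativeDimension_algebraMap]
  exact isStandardSmoothOfRelativeDimension_coeffRing k n d

/-- **`𝒴°` is smooth over `k` of relative dimension `n + #{m}`** (`𝒴° → S^d` smooth of relative dimension `n`, then the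
affine space `S^d`). [cite: Hartshorne1977, III Thm. 10.2 and Example 10.0.1] -/
theorem smoothOfRelativeDimension_regularTotal_hom (hd : 0 < d) :
    SmoothOfRelativeDimension (n + Fintype.card (DegIndex n d)) (regularTotal k n d).hom := by
  haveI : SmoothOfRelativeDimension n (regularToSpec k n d) := smoothOfRelativeDimension_regularToSpec k n d hd
  haveI : SmoothOfRelativeDimension (Fintype.card (DegIndex n d)) (specCoeffToSpec k n d) :=
    smoothOfRelativeDimension_affineBase_hom k n d
  change SmoothOfRelativeDimension _ (regularToSpec k n d ≫ specCoeffToSpec k n d)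
  infer_instance

/-- `𝒴° → S^d` is smooth (as the underlying morphism of `regularFamily`). [cite: Hartshorne1977, III Thm. 10.2] -/
theorem smooth_regularFamily_left (hd : 0 < d) : Smooth (regularFamily k n d).left := by
  rw [regularFamily_left]
  haveI : SmoothOfRelativeDimension n (regularToSpec k n d) := smoothOfRelativeDimension_regularToSpec k n d hd
  exact SmoothOfRelativeDimension.smooth n (regularToSpec k n d)

/-- `S^d → Spec k` is smooth. [cite: Hartshorne1977, III §10 Example 10.0.1] -/
theorem smooth_affineBase_hom : Smooth (affineBase k n d).hom := by
  haveI : SmoothOfRelativeDimension (Fintype.card (DegIndex n d)) (affineBase k n d).hom :=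
    smoothOfRelativeDimension_affineBase_hom k n d
  exact SmoothOfRelativeDimension.smooth (Fintype.card (DegIndex n d)) (affineBase k n d).hom

/-- `𝒴°` is locally of finite type over `k` (it is smooth). [cite: Hartshorne1977, III Thm. 10.2] -/
theorem locallyOfFiniteType_regularTotal_hom (hd : 0 < d) : LocallyOfFiniteType (regularTotal k n d).hom := by
  haveI : SmoothOfRelativeDimension (n + Fintype.card (DegIndex n d)) (regularTotal k n d).hom :=
    smoothOfRelativeDimension_regularTotal_hom k n d hd
  haveI : Smooth (regularTotal k n d).hom :=
    SmoothOfRelativeDimension.smooth (n + Fintype.card (DegIndex n d)) (regularTotal k n d).hom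
  infer_instance

/-- `S^d` is locally of finite type over `k` (affine space). [cite: Hartshorne1977, III §10 Example 10.0.1] -/
theorem locallyOfFiniteType_affineBase_hom : LocallyOfFiniteType (affineBase k n d).hom := by
  haveI : Smooth (affineBase k n d).hom := smooth_affineBase_hom k n d
  infer_instance

/-- `𝒴°` is separated over `k` (open in the proper `𝒴 → S^d`, and `S^d` affine). [cite: Hartshorne1977, II Thm. 4.9] -/
theorem isSeparated_regularTotal_hom : IsSeparated (regularTotal k n d).hom := by
  change IsSeparated (((regularLocus k n d).ι ≫ totalToSpec k n d) ≫ specCoeffToSpec k n d)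
  infer_instance

/-! ### The smooth family inside the regular locus -/

/-- The inclusion `U ↪ S^d` of the nonsingular forms, as a morphism of `k`-schemes. [cite: VoisinHodgeII2003, §6.2.1] -/
def baseToAffine : base k n d ⟶ affineBase k n d := Over.homMk (baseOpens k n d).ι rfl

/-- **The open immersion `𝒴_U ↪ 𝒴°` of the universal SMOOTH family into the regular locus**, over `U ↪ S^d`.
[cite: VoisinHodgeII2003, §6.2.1] -/
def totalToRegular : total k n d ⟶ regularTotal k n d :=
  Over.homMk (Scheme.homOfLE (totalSpace k n d) (preimage_baseOpens_le_regularLocus k n d)) (by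
    change Scheme.homOfLE (totalSpace k n d) (preimage_baseOpens_le_regularLocus k n d) ≫
        ((regularLocus k n d).ι ≫ totalToSpec k n d) ≫ specCoeffToSpec k n d =
      (totalToSpec k n d ∣_ baseOpens k n d) ≫ (baseOpens k n d).ι ≫ specCoeffToSpec k n d
    rw [← Category.assoc, ← Category.assoc, Scheme.homOfLE_ι, morphismRestrict_ι_assoc, Category.assoc])

/-- The underlying morphism of `totalToRegular` is an open immersion. [cite: VoisinHodgeII2003, §6.2.1] -/
instance isOpenImmersion_totalToRegular_left : IsOpenImmersion (totalToRegular k n d).left := by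
  change IsOpenImmersion (Scheme.homOfLE (totalSpace k n d) (preimage_baseOpens_le_regularLocus k n d))
  infer_instance

/-- The square `𝒴_U → 𝒴°`, `U → S^d` commutes: `totalToRegular ≫ regularFamily = family ≫ baseToAffine`.
[cite: VoisinHodgeII2003, §6.2.1] -/
theorem totalToRegular_comp_regularFamily :
    totalToRegular k n d ≫ regularFamily k n d = family k n d ≫ baseToAffine k n d := by
  ext : 1
  change Scheme.homOfLE (totalSpace k n d) (preimage_baseOpens_le_regularLocus k n d) ≫
      ((regularLocus k n d).ι ≫ totalToSpec k n d) =
    (totalToSpec k n d ∣_ baseOpens k n d) ≫ (baseOpens k n d).ι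
  rw [← Category.assoc, Scheme.homOfLE_ι, morphismRestrict_ι]

end Literature.AlgebraicGeometry.Motives.UniversalHypersurface

end
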